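import Summits.Ventures.GridStability.Lyapunov.AngleRecovery
import Summits.Ventures.GridStability.Models.Polynomialise
import HarnessLib

/-!
# Angle recovery for the multimachine recast: from `z(t) → 0`, `κ_i(t) < 2` back to relative angles and speeds

Venture GRIDFUSION, `plan/PARTITION.md` A5 (bridge) + A6 (pole-slip rule, one arc conjunct PER
RELATIVE ANGLE), seat gridfusion-lyap-1; namespace `Summit.Ventures.GridStability.Lyapunov`.
Model-independent last step of every multimachine «-roa» file (WSCC9, NE39, …): the certificate
bridge (`CertificateSoundness.lean`, instantiated per Bench file) concludes, for the recast curve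
`z(t) = RecastData.embed δs (c t)` of a solution `c` of model-1's `RecastData.toModel`
(`Models/Polynomialise.lean`: coordinates `2i ↦ sin u_{i+1}`, `2i+1 ↦ 1 − cos u_{i+1}`,
`2n+j ↦ ω_j`, `u_i` = deviation of the relative angle `δ_i − δ_0` from its equilibrium value), that
every coordinate tends to `0` and that the arc bounds `κ_i = 1 − cos u_i ≤ κ_max < 2` persist.
`recast_angle_recovery` turns this into the sentence A6 licenses, in ORIGINAL coordinates: no
relative angle ever reaches `±π` (no pole slip), every relative-angle deviation `u_i(t) → 0`, and
every speed deviation `ω_j(t) → 0` — by `abs_lt_pi_of_neg_one_lt_cos` (IVT) and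
`tendsto_zero_of_one_sub_cos_tendsto` (Jordan) from `AngleRecovery.lean`, machine by machine.
MODELLED/CERTIFIED: nothing here; pure real analysis over model-1's `embed`/`u`. Absolute angles are
not claimed to converge (only their differences and all speeds), which is what synchronism means.
-/

noncomputable section

open Set Filter Topology Real
open Summit.Ventures.GridStability.Models

namespace Summit.Ventures.GridStability.Lyapunov

/-- **Multimachine angle recovery (A6, original coordinates).** Let `c` be a curve in the state
space of the `(n+1)`-machine classical model, continuous on `[0, ∞)`, such that along it every
recast coordinate `RecastData.embed δs (c t) k`, `k < 3n+1`, tends to `0`, the arc bound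
`1 − cos u_{i+1}(t) < 2` holds for all `t ≥ 0` and every relative angle, and initially
`|u_{i+1}(0)| < π`. Then for every relative angle: `|u_{i+1}(t)| < π` for all `t ≥ 0` (no pole
slip) and `u_{i+1}(t) → 0`; and every speed deviation `ω_j(t) → 0`. [folklore] -/
theorem recast_angle_recovery {n : ℕ} (δs : Fin (n + 1) → ℝ)
    {c : ℝ → ClassicalSwing.State (n + 1)} (hc : ContinuousOn c (Ici 0))
    (hlim : ∀ k : ℕ, k < 3 * n + 1 →
      Tendsto (fun t ↦ RecastData.embed δs (c t) k) atTop (𝓝 0))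
    (hκ : ∀ i : Fin n, ∀ t, 0 ≤ t → RecastData.embed δs (c t) (2 * i.val + 1) < 2)
    (h0 : ∀ i : Fin n, |RecastData.u δs (c 0) i.succ| < π) :
    (∀ i : Fin n, ∀ t, 0 ≤ t → |RecastData.u δs (c t) i.succ| < π) ∧
    (∀ i : Fin n, Tendsto (fun t ↦ RecastData.u δs (c t) i.succ) atTop (𝓝 0)) ∧
    (∀ j : Fin (n + 1), Tendsto (fun t ↦ (c t).2 j) atTop (𝓝 0)) := by
  -- continuity of each relative-angle deviation along the curve
  have hu : ∀ i : Fin n, ContinuousOn (fun t ↦ RecastData.u δs (c t) i.succ) (Ici 0) := by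
    intro i
    have h : Continuous fun x : ClassicalSwing.State (n + 1) ↦ RecastData.u δs x i.succ := by
      unfold RecastData.u; fun_prop
    exact h.comp_continuousOn hc
  -- the arc bound gives `cos u > -1`
  have hcos : ∀ i : Fin n, ∀ t, 0 ≤ t → -1 < cos (RecastData.u δs (c t) i.succ) := by
    intro i t ht
    have h := hκ i t ht
    rw [RecastData.embed_κ] at h
    linarith
  have hwin : ∀ i : Fin n, ∀ t, 0 ≤ t → |RecastData.u δs (c t) i.succ| < π := fun i ↦
    abs_lt_pi_of_neg_one_lt_cos (hu i) (h0 i) (hcos i)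
  refine ⟨hwin, fun i ↦ ?_, fun j ↦ ?_⟩
  · -- `1 - cos u_{i+1} → 0`, hence `u_{i+1} → 0` inside the window
    have h := hlim (2 * i.val + 1) (by omega)
    simp only [RecastData.embed_κ] at h
    exact tendsto_zero_of_one_sub_cos_tendsto (hwin i) h
  · -- speeds: coordinate `2n + j`
    have h := hlim (2 * n + j.val) (by omega)
    simpa only [RecastData.embed_ω] using h

end Summit.Ventures.GridStability.Lyapunov

end
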